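import Literature.Combinatorics.Enumerative.MultivariateAperyJacobsthalRatioProofs
import Mathlib.Tactic
import HarnessLib

/-!
# Osburn–Sahu–Straub 2016, Lemma 2.3: `ℬ(np^r, kp^s) ≡ ℬ(np^{r−1}, kp^{s−1}) (mod p^{3r})` via Jacobsthal's congruence

Topic `Literature/Combinatorics/Enumerative`, namespace `Literature.Combinatorics.Enumerative.SporadicSupercongruenceProofs`
(first of the chain `SporadicSupercongruenceTermProofs` / `…HalfBlockProofs` → `…GZeroProofs` → `…Proofs`, which
DISCHARGES the named fact `AperyGaussCongruences.oss2016_theorem12`). PROOF FILE: sorry-free theorems only — no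
definition, no named fact. Source read on the page (held `paper:arxiv-1312.2195`, §2 pp. 5–6): R. Osburn, B. Sahu,
A. Straub, *Supercongruences for sporadic sequences*, Proc. Edinb. Math. Soc. **59** (2016) 503–518
[OsburnSahuStraub2016]. The route is the printed one; the Jacobsthal unit-ratio dictionary and the factors
`C(p^r m, p^s k)`, `p^{R−S} ∣ C(p^R m, p^S k)` are the tree's (`MultivariateAperyJacobsthalRatioProofs`, Straub 2014
Lemma 5.3). HONEST FRAMING (cell pub-zeta5): a classical prime-power congruence for Apéry-like numbers; nothing here
concerns `ζ(5)` or any irrationality statement.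

## What is printed (verbatim, [OsburnSahuStraub2016] §2)

«Lemma 2.1. For primes `p ≥ 5`, integers `a, b` and integers `r, s ≥ 1`,
`C(p^r a, p^s b)/C(p^{r−1} a, p^{s−1} b) ≡ 1 (mod p^{r+s+min(r,s)})`.»
«Lemma 2.3. For integers `n`, `k ≥ 1` and `A, B, C ≥ 0`, define
`ℬ(n, k) = ℬ(n, k; A,B,C) = C(n,k)^A C(n+k,k)^B C(2k,n)^C`. Then, for primes `p ≥ 5` and integers `A ≥ 2`,
`r, s ≥ 1` and `k ≥ 0` such that `p ∤ k`, (eq. Bind) `ℬ(np^r, kp^s) ≡ ℬ(np^{r−1}, kp^{s−1}) (mod p^{3r})`.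
Proof. By Jacobsthal's congruence, we have `C(np^r, kp^s)/C(np^{r−1}, kp^{s−1}) ≡ 1 (mod p^{r+s+min(r,s)})` as
well as `C(np^r + kp^s, np^r)/C(np^{r−1} + kp^{s−1}, np^{r−1}) ≡ 1 (mod p^{r+2min(r,s)})` and
`C(2kp^s, np^r)/C(2kp^{s−1}, np^{r−1}) ≡ 1 (mod p^{r+s+min(r,s)})`. Thus, if `s ≥ r` then congruence (Bind)
follows immediately upon applying Jacobsthal's congruence to each binomial coefficient. On the other hand, suppose
`s ≤ r`. Then the same approach yields `ℬ(np^r, kp^s) = λ ℬ(np^{r−1}, kp^{s−1})` with `λ ≡ 1` modulo `p^{r+2s}`.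
Moreover, since `p ∤ k`, we have `C(np^r, kp^s) ≡ C(np^{r−1}, kp^{s−1}) ≡ 0 (mod p^{r−s})`. As `A ≥ 2`, it
follows that `p^{2(r−s)}` divides `ℬ(np^r, kp^s)`. Since `r + 2s + 2(r−s) = 3r`, congruence (Bind) follows.»

## Dictionary and what is proved (natural-number arguments, `n = m ≥ 1`, `k ≥ 1`)

As in the tree's Straub files, «`X/Y ≡ 1 (mod p^N)`» is the UNIT-RATIO RELATION `∃ x y, p ∤ y ∧ y·X = x·Y ∧
x ≡ y (mod p^N)`; `MultivariateAperyPrimePowerProofs.modEq_of_ratio` turns it plus `p^e ∣ Y` into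
`X ≡ Y (mod p^{N+e})`. The three factors: `C(p^r m, p^s k)` and `C(2kp^s, mp^r) = C(p^s(2k), p^r m)` are the
tree's `ratio_choose`; `C(mp^r + kp^s, kp^s)` (the printed middle factor, by `C(n+k, n) = C(n+k, k)`) is
`ratio_choose_add` below (valuation count `3 + v(a) + v(b) + v(a−b) ≥ r + s + min(r,s)` for
`a = p^{r−1}m + p^{s−1}k`, `b = p^{s−1}k`, `a − b = p^{r−1}m`).

* `ratio_choose_add` — Jacobsthal for the middle factor; **`termS_modEq`** — Lemma 2.3 (eq. Bind) for
  `ℬ(n,k; A,B,C)` with `A ≥ 2`, written with the last factor as `C(p^s(2k), p^r m)`.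
-/

open Finset

namespace Literature.Combinatorics.Enumerative.SporadicSupercongruenceProofs

open Literature.NumberTheory.Congruences (Jacobsthal.exists_ratio)
open MultivariateAperyPrimePowerProofs (ratio_choose pow_sub_dvd_choose modEq_of_ratio)

section Ratio

variable {p : ℕ} [hp : Fact p.Prime]

/-- Unit-ratio relations multiply. [folklore] -/
private theorem ratio_mul_oss {N X X' Y Y' : ℕ}
    (hX : ∃ x y : ℕ, ¬ p ∣ y ∧ y * X = x * X' ∧ x ≡ y [MOD p ^ N])
    (hY : ∃ x y : ℕ, ¬ p ∣ y ∧ y * Y = x * Y' ∧ x ≡ y [MOD p ^ N]) :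
    ∃ x y : ℕ, ¬ p ∣ y ∧ y * (X * Y) = x * (X' * Y') ∧ x ≡ y [MOD p ^ N] := by
  obtain ⟨x₁, y₁, hy₁, h₁, hm₁⟩ := hX
  obtain ⟨x₂, y₂, hy₂, h₂, hm₂⟩ := hY
  refine ⟨x₁ * x₂, y₁ * y₂, fun h => ?_, ?_, hm₁.mul hm₂⟩
  · rcases (Nat.Prime.dvd_mul hp.out).mp h with h | h
    · exact hy₁ h
    · exact hy₂ h
  · calc y₁ * y₂ * (X * Y) = (y₁ * X) * (y₂ * Y) := by ring
      _ = (x₁ * X') * (x₂ * Y') := by rw [h₁, h₂]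
      _ = x₁ * x₂ * (X' * Y') := by ring

omit hp in
/-- Unit-ratio relations weaken to smaller moduli. [folklore] -/
private theorem ratio_of_le_oss {N N' X X' : ℕ} (hN : N' ≤ N)
    (hX : ∃ x y : ℕ, ¬ p ∣ y ∧ y * X = x * X' ∧ x ≡ y [MOD p ^ N]) :
    ∃ x y : ℕ, ¬ p ∣ y ∧ y * X = x * X' ∧ x ≡ y [MOD p ^ N'] := by
  obtain ⟨x, y, hy, h, hm⟩ := hX
  exact ⟨x, y, hy, h, hm.of_dvd (pow_dvd_pow p hN)⟩

/-- The trivial unit-ratio relation between equal numbers. [folklore] -/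
private theorem ratio_refl_oss {N X : ℕ} : ∃ x y : ℕ, ¬ p ∣ y ∧ y * X = x * X ∧ x ≡ y [MOD p ^ N] :=
  ⟨1, 1, fun h => hp.out.one_lt.ne' (Nat.eq_one_of_dvd_one h), rfl, Nat.ModEq.refl 1⟩

/-- Unit-ratio relations pass to powers. [folklore] -/
private theorem ratio_pow_oss {N X X' : ℕ}
    (hX : ∃ x y : ℕ, ¬ p ∣ y ∧ y * X = x * X' ∧ x ≡ y [MOD p ^ N]) :
    ∀ e : ℕ, ∃ x y : ℕ, ¬ p ∣ y ∧ y * X ^ e = x * X' ^ e ∧ x ≡ y [MOD p ^ N]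
  | 0 => by rw [pow_zero, pow_zero]; exact ratio_refl_oss
  | e + 1 => by
    rw [pow_succ, pow_succ]
    exact ratio_mul_oss (ratio_pow_oss hX e) hX

/-- If `p^t ∣ a` with `a ≠ 0` then `t ≤ v_p(a)`. [folklore] -/
private theorem le_padicValNat_of_pow_dvd_oss {t a : ℕ} (ha : a ≠ 0) (h : p ^ t ∣ a) : t ≤ padicValNat p a :=
  (padicValNat_dvd_iff_le ha).mp h

/-- **Jacobsthal for the middle factor `C(n+k, k)` of `ℬ(n,k)`** (OSS, proof of Lemma 2.3, read through
`C(np^r + kp^s, np^r) = C(np^r + kp^s, kp^s)`): for `p ≥ 5`, `r, s ≥ 1`, `k ≥ 1` and every `m`,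
`C(p^r m + p^s k, p^s k)/C(p^{r−1} m + p^{s−1} k, p^{s−1} k) ≡ 1 (mod p^{r+s+min(r,s)})` as a unit ratio (the
printed modulus `p^{r+2min(r,s)}` is weaker). [cite: OsburnSahuStraub2016, Lemma 2.3 (proof) with Lemma 2.1] -/
theorem ratio_choose_add (h3 : 3 < p) {r s : ℕ} (hr : 1 ≤ r) (hs : 1 ≤ s) {k : ℕ} (hk : 1 ≤ k) (m : ℕ) :
    ∃ x y : ℕ, ¬ p ∣ y ∧ y * (p ^ r * m + p ^ s * k).choose (p ^ s * k) =
      x * (p ^ (r - 1) * m + p ^ (s - 1) * k).choose (p ^ (s - 1) * k) ∧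
      x ≡ y [MOD p ^ (r + s + min r s)] := by
  have hp' := hp.out
  set a := p ^ (r - 1) * m + p ^ (s - 1) * k with ha
  set b := p ^ (s - 1) * k with hb
  have hpow : ∀ {t : ℕ}, 1 ≤ t → ∀ n : ℕ, p ^ t * n = p ^ (t - 1) * n * p := fun {t} ht n => by
    rw [mul_comm (p ^ (t - 1) * n) p, ← mul_assoc, ← pow_succ', Nat.sub_add_cancel ht]
  have hap : p ^ r * m + p ^ s * k = a * p := by rw [hpow hr, hpow hs, ha, Nat.add_mul]
  have hbp : p ^ s * k = b * p := hpow hs k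
  rw [hap, hbp]
  rcases Nat.eq_zero_or_pos m with hm | hm
  · have hab : a = b := by rw [ha, hb, hm, mul_zero, zero_add]
    rw [hab, Nat.choose_self, Nat.choose_self]
    exact ratio_refl_oss
  · have hb0 : b ≠ 0 := Nat.mul_ne_zero (pow_ne_zero _ hp'.ne_zero) (by omega)
    have hm0 : p ^ (r - 1) * m ≠ 0 := Nat.mul_ne_zero (pow_ne_zero _ hp'.ne_zero) (by omega)
    have ha0 : a ≠ 0 := by rw [ha]; omega
    have hmin : p ^ (min r s - 1) ∣ p ^ (r - 1) := pow_dvd_pow p (by omega)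
    have hmin' : p ^ (min r s - 1) ∣ p ^ (s - 1) := pow_dvd_pow p (by omega)
    have hva : min r s - 1 ≤ padicValNat p a := by
      refine le_padicValNat_of_pow_dvd_oss ha0 (dvd_add ?_ ?_)
      · exact hmin.trans (Dvd.intro m rfl)
      · exact hmin'.trans (Dvd.intro k rfl)
    have hvb : s - 1 ≤ padicValNat p b := le_padicValNat_of_pow_dvd_oss hb0 (Dvd.intro k rfl)
    have hsub : a - b = p ^ (r - 1) * m := by rw [ha, hb]; omega
    have hvab : r - 1 ≤ padicValNat p (a - b) := by
      rw [hsub]; exact le_padicValNat_of_pow_dvd_oss hm0 (Dvd.intro m rfl)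
    exact ratio_of_le_oss (by omega) (Jacobsthal.exists_ratio (p := p) h3 a b)

/-- **Osburn–Sahu–Straub 2016, Lemma 2.3 (eq. Bind)**: for a prime `p ≥ 5`, `A ≥ 2`, `B, C ≥ 0`, `r, s ≥ 1`,
`m ≥ 1` and `k ≥ 1` with `p ∤ k`,
`ℬ(mp^r, kp^s) ≡ ℬ(mp^{r−1}, kp^{s−1}) (mod p^{3r})` for `ℬ(n,k) = C(n,k)^A C(n+k,k)^B C(2k,n)^C`
(the last factor written `C(p^s(2k), p^r m)`). Printed route: the three unit ratios are `≡ 1 (mod p^{r+2min(r,s)})`,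
and for `s < r` the extra `p^{2(r−s)} ∣ C(p^{r−1}m, p^{s−1}k)^A` (`A ≥ 2`, `p ∤ k`); `r + 2min(r,s) + 2(r−s) = 3r`.
[cite: OsburnSahuStraub2016, Lemma 2.3] -/
theorem termS_modEq (h3 : 3 < p) {A : ℕ} (hA : 2 ≤ A) (B C : ℕ) {r s : ℕ} (hr : 1 ≤ r) (hs : 1 ≤ s)
    {k : ℕ} (hk : 1 ≤ k) (hpk : ¬ p ∣ k) {m : ℕ} (hm : 1 ≤ m) :
    ((((p ^ r * m).choose (p ^ s * k)) ^ A * ((p ^ r * m + p ^ s * k).choose (p ^ s * k)) ^ B *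
        ((p ^ s * (2 * k)).choose (p ^ r * m)) ^ C : ℕ) : ℤ) ≡
      ((((p ^ (r - 1) * m).choose (p ^ (s - 1) * k)) ^ A *
        ((p ^ (r - 1) * m + p ^ (s - 1) * k).choose (p ^ (s - 1) * k)) ^ B *
        ((p ^ (s - 1) * (2 * k)).choose (p ^ (r - 1) * m)) ^ C : ℕ) : ℤ) [ZMOD (p : ℤ) ^ (3 * r)] := by
  have hle : r + 2 * min r s ≤ r + s + min r s := by omega
  have hle' : r + 2 * min r s ≤ s + r + min s r := by omega
  have h1 := ratio_pow_oss (ratio_of_le_oss hle (ratio_choose (p := p) h3 hr hs hk m)) A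
  have h2 := ratio_pow_oss (ratio_of_le_oss hle (ratio_choose_add (p := p) h3 hr hs hk m)) B
  have h3' := ratio_pow_oss (ratio_of_le_oss hle' (ratio_choose (p := p) h3 hs hr hm (2 * k))) C
  have hall := ratio_mul_oss (ratio_mul_oss h1 h2) h3'
  -- the extra divisibility `p^{2(r−s)} ∣ ℬ(mp^{r−1}, kp^{s−1})` when `s < r`
  have hdiv : p ^ (2 * (r - s)) ∣ ((p ^ (r - 1) * m).choose (p ^ (s - 1) * k)) ^ A *
      ((p ^ (r - 1) * m + p ^ (s - 1) * k).choose (p ^ (s - 1) * k)) ^ B *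
      ((p ^ (s - 1) * (2 * k)).choose (p ^ (r - 1) * m)) ^ C := by
    rcases Nat.lt_or_ge s r with hsr | hrs
    swap
    · rw [show r - s = 0 by omega, mul_zero, pow_zero]; exact one_dvd _
    · have h := pow_sub_dvd_choose (p := p) (show s - 1 ≤ r - 1 by omega) hk hpk m
      rw [show r - 1 - (s - 1) = r - s by omega] at h
      have h2 : p ^ (2 * (r - s)) ∣ ((p ^ (r - 1) * m).choose (p ^ (s - 1) * k)) ^ A := by
        rw [pow_mul']
        exact (pow_dvd_pow_of_dvd h 2).trans (pow_dvd_pow _ hA)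
      exact (h2.mul_right _).mul_right _
  have := modEq_of_ratio hall hdiv
  rw [show r + 2 * min r s + 2 * (r - s) = 3 * r by omega] at this
  exact this

end Ratio

end Literature.Combinatorics.Enumerative.SporadicSupercongruenceProofs
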